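import Literature.AnabelianGeometry.EtaleTheta.Discharge.Sec2Prop26TrueAtMonodromyModel
import Literature.AnabelianGeometry.AbsoluteAnabelian.AbsTopI.CharOpenBasis
import HarnessLib

/-!
# [EtTh] Prop. 2.6, profinite clause, at the monodromy model — part 1: the ROTATION CLOSURE `R = cl(η⟨t⟩)` inside
# `Π_C = (TG l)^∧` (abelian, inverted by `η(ι)`, acting on `η((ℤ/l)²)` through the rotation index) and a generation lemma
# for `TG l` (proof-only)

S. Mochizuki, *The étale theta function and its Frobenioid-theoretic manifestations* [EtTh], Publ. RIMS **45** (2009), §2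
Prop. 2.6, PRIMS p. 266 = PDF p. 40: «any isomorphism of topological groups `Π^tp_{Ẋ̲̲_α} ⥲ Π^tp_{Ẋ̲̲_β}` (respectively, `Ẋ̲`; `Ċ̲̲`;
`Ċ̲`) induces isomorphisms compatible with the various natural maps between the respective "`Π^tp`'s" of `X̲̲` (respectively, `X̲`;
`C̲̲`; `C̲`) and `Ċ`. A similar statement holds when "`Π^tp`" is replaced by "`Π`".» [cite: MochizukiEtTh2009, Prop 2.6 p.40];
§1 p. 12 «`Π_X := (Π^tp_X)^∧`» [cite: MochizukiEtTh2009, §1 p.12].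

Cell abc-iut, block F (FACT-proving wave), seat abc-iut-f-142 (gen 13), FACT-LIST row **F-0611**
`ThetaCovers.TemperedCoverData.Prop26_profinite` (the LAST SENTENCE of Prop. 2.6 as typed by abc-iut-L2-t2: automorphisms of the
profinite `Π_Ż` of a dotted member extend to `Π_C` stabilising the closures; class «universal-closure REFUTED / schema»,
abc-iut-f-143 `TemperedModel.not_forall_prop26_profinite`; instance form returned OPEN-SIZED by abc-iut-f-108 g4, «MONODROMY `Π_C`
COORDINATES»). This lineage decides the instance form at abc-iut-w6-d084's MONODROMY MODEL `monodromyModel l hl`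
(`ThetaCoversMonodromyModel{Defs,Theta,Tempered,Aut}.lean`, tempered twin PROVED: `prop26_monodromyModel`) WITHOUT coordinatising the
abstract profinite completion `Π_C = (TG l)^∧`: everything is derived from density of `η = toHat`, continuity, the finite shadow
`Φ : Π_C ↠ (ℤ/l × ℤ/l) ⋊ D_l` and the universal property of Mathlib's `ProfiniteGrp.ProfiniteCompletion`.

THIS FILE (part 1 of 3 + a structure file + the instance file). §0 generic helpers: the universal property of the completion
with a PROFINITE target (`exists_continuousMonoidHom_extend_profinite`), homomorphisms out of `D_∞ = DihedralGroup 0` from a pair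
`(x, y)` with `y² = 1`, `y x y⁻¹ = x⁻¹` (`exists_monoidHom_dihedralZero`, `monoidHom_dihedralZero_ext`), centrality by density, and
«two continuous maps on `cl(M)` agreeing on `M` agree» (`eq_of_eqOn_subgroup_of_continuous`). §1 the rotation closure
`R := cl(η⟨t⟩)`, `t = embCu (1, r 1)` the loop (statements carry `R` through the hypothesis `hR : R = …`): `Φ(R) ⊆ ⟨r⟩`
(`exists_Phi_eq_inr_r_of_mem_rot`), `η(ι) x η(ι)⁻¹ = x⁻¹` on `R` (`iotaM_conj_of_mem_rot`), `R` abelian (`comm_of_mem_rot`),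
`x · η(inl v) · x⁻¹ = η(inl(r^{λ(x)} v))` for `x ∈ R`, `λ = rotIdx ∘ Φ` (`conj_toHat_inl_of_mem_rot`); the normal form
`g = inl(v) · embCu(1, d) · (1, e)` in `TG l` and the generation lemma `monoidHom_TG_ext`. Sequel: part 2
`Sec2MonodromyModelHatScalings.lean` (the `Ẑ^×`-type scalings `Σ_ρ` of `Π_C` extending ANY topological automorphism `ρ` of `R`).

HONEST LABEL (abc-iut-L2-lead R1352, inherited from the carrier): «a DESIGNED tempered toy with print's monodromy combinatorics —
loop ↦ `Δ̄^ell` (`b`-cycle), the inversion INVERTS it, unipotent monodromy `x ↦ x·z` on the `a`-cycle, `z` = cusp inertia = `Δ̄_Θ`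
central; `G_K := 1`; NOT a Tate curve, NOT the tempered fundamental group of a curve; consistency ≠ faithfulness.» PROOF-ONLY
companion (0 `def`, 0 `instance`, 0 notation, 0 `Prop`-definition; nothing of abc-iut-w6-d084's model files or of abc-iut-L2-t2's
interface is edited or restated). Instance-at-OUR-carrier ≠ [EtTh] Prop. 2.6 for the profinite fundamental groups of a curve;
typed ≠ proved; no side is taken on [IUTchIII] Cor. 3.12 or on any author; nothing here asserts abc proved or refuted.
-/

noncomputable section

namespace Literature.AnabelianGeometry.EtaleTheta.ThetaCovers.MonodromyModel

open Multiplicative HeisenbergWitness TemperedModel DihedralGroup Topology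
open Literature.AnabelianGeometry.SemiGraphs

variable (l : ℕ)

/-! ## 0. Generic helpers -/

/-- Universal property of the profinite completion, continuous form, for a PROFINITE target: every homomorphism
from a discrete group `G` to a profinite group `P` extends along `η` to a continuous homomorphism `Ĝ → P`.
(folklore; no claim about print) [cite: MochizukiEtTh2009, §1 p.12] -/
theorem exists_continuousMonoidHom_extend_profinite (G : Type) [Group G] (P : ProfiniteGrp.{0}) (f : G →* P) :
    ∃ F : ProfiniteGrp.ProfiniteCompletion.completion (GrpCat.of G) →ₜ* P,
      ∀ g, F (ProfiniteGrp.ProfiniteCompletion.etaFn (GrpCat.of G) g) = f g := by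
  let Gc : GrpCat.{0} := GrpCat.of G
  let φ : Gc ⟶ GrpCat.of P := GrpCat.ofHom f
  let L := ProfiniteGrp.ProfiniteCompletion.lift φ
  refine ⟨L.hom, fun g => ?_⟩
  have h := CategoryTheory.ConcreteCategory.congr_hom (ProfiniteGrp.ProfiniteCompletion.lift_eta φ) g
  simp only [GrpCat.comp_apply] at h
  exact h

/-- Homomorphisms out of `D_∞ = DihedralGroup 0` from a pair `(x, y)` with `y² = 1`, `y x y⁻¹ = x⁻¹`:
`r i ↦ x^i`, `sr i ↦ y x^i`. (folklore; no claim about print) [cite: MochizukiEtTh2009, §1 p.12] -/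
theorem exists_monoidHom_dihedralZero {H : Type*} [Group H] (x y : H) (hy : y * y = 1) (hxy : y * x * y⁻¹ = x⁻¹) :
    ∃ f : DihedralGroup 0 →* H, (∀ i : ZMod 0, f (r i) = x ^ (show ℤ from i)) ∧
      ∀ i : ZMod 0, f (sr i) = y * x ^ (show ℤ from i) := by
  have hyinv : y⁻¹ = y := by
    rw [inv_eq_iff_mul_eq_one, hy]
  have hconj : ∀ k : ℤ, y * x ^ k * y = x ^ (-k) := by
    intro k
    have h1 : y * x ^ k * y⁻¹ = (y * x * y⁻¹) ^ k := by
      rw [← MulAut.conj_apply, ← MulAut.conj_apply, map_zpow]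
    rw [hxy, inv_zpow', hyinv] at h1
    exact h1
  have hxy' : ∀ k : ℤ, x ^ k * y = y * x ^ (-k) := by
    intro k
    rw [← hconj, ← mul_assoc, ← mul_assoc, hy, one_mul]
  let F : DihedralGroup 0 → H := fun g => match g with
    | r i => x ^ (show ℤ from i)
    | sr i => y * x ^ (show ℤ from i)
  refine ⟨{ toFun := F, map_one' := ?_, map_mul' := ?_ }, fun i => rfl, fun i => rfl⟩
  · change F (r 0) = 1
    exact zpow_zero x
  · have k1 : ∀ a b : ℤ, x ^ (a + b) = x ^ a * x ^ b := fun a b => zpow_add x a b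
    have k2 : ∀ a b : ℤ, y * x ^ (b - a) = x ^ a * (y * x ^ b) := fun a b => by
      rw [← mul_assoc, hxy', mul_assoc, ← zpow_add, sub_eq_neg_add]
    have k3 : ∀ a b : ℤ, y * x ^ (a + b) = y * x ^ a * x ^ b := fun a b => by
      rw [mul_assoc, ← zpow_add]
    have k4 : ∀ a b : ℤ, x ^ (b - a) = y * x ^ a * (y * x ^ b) := fun a b => by
      rw [show y * x ^ a * (y * x ^ b) = (y * x ^ a * y) * x ^ b by simp only [mul_assoc], hconj, ← zpow_add,
        sub_eq_neg_add]
    intro g h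
    rcases g with i | i <;> rcases h with j | j
    · simp only [r_mul_r, F]
      exact k1 i j
    · simp only [r_mul_sr, F]
      exact k2 i j
    · simp only [sr_mul_r, F]
      exact k3 i j
    · simp only [sr_mul_sr, F]
      exact k4 i j

/-- Homomorphisms out of `D_∞` are determined by their values at `r 1` and `sr 0`. (folklore; no claim about print)
[cite: MochizukiEtTh2009, §1 p.12] -/
theorem monoidHom_dihedralZero_ext {H : Type*} [Group H] {f g : DihedralGroup 0 →* H} (h1 : f (r 1) = g (r 1))
    (h2 : f (sr 0) = g (sr 0)) : f = g := by
  ext d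
  have hr : ∀ i : ZMod 0, f (r i) = g (r i) := fun i => by
    have e : r i = (r 1 : DihedralGroup 0) ^ (show ℤ from i) := (r_one_zpow_int (show ℤ from i)).symm
    rw [e, map_zpow, map_zpow, h1]
  rcases d with i | i
  · exact hr i
  · rw [show sr i = sr 0 * r i by rw [sr_mul_r, zero_add], map_mul, map_mul, h2, hr]

/-- An element commuting with a dense subgroup's image commutes with everything. (folklore; no claim about print)
[cite: MochizukiEtTh2009, §1 p.12] -/
theorem commute_of_denseRange {G H : Type*} [Group G] [Group H] [TopologicalSpace H] [IsTopologicalGroup H]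
    [T2Space H] {η : G →* H} (hη : DenseRange η) (c : H) (hc : ∀ g, Commute c (η g)) (x : H) : Commute c x := by
  have key := hη.equalizer (continuous_const.mul continuous_id) (continuous_id.mul continuous_const)
    (funext fun g => (hc g).eq)
  exact congrFun key x

/-- Two continuous maps out of the closure of a subgroup that agree on the subgroup are equal.
(folklore; no claim about print) [cite: MochizukiEtTh2009, §1 p.12] -/
theorem eq_of_eqOn_subgroup_of_continuous {H Y : Type*} [Group H] [TopologicalSpace H] [IsTopologicalGroup H]
    [TopologicalSpace Y] [T2Space Y] (M : Subgroup H) {f g : ↥M.topologicalClosure → Y} (hf : Continuous f)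
    (hg : Continuous g) (h : ∀ (x : H) (hx : x ∈ M), f ⟨x, M.le_topologicalClosure hx⟩ = g ⟨x, M.le_topologicalClosure hx⟩) :
    f = g := by
  -- the inclusion `M → cl(M)` has dense range
  set incl : M → ↥M.topologicalClosure := fun m => ⟨m, M.le_topologicalClosure m.2⟩ with hincl
  have himg : Subtype.val '' Set.range incl = (M : Set H) := by
    ext y
    constructor
    · rintro ⟨_, ⟨m, rfl⟩, rfl⟩
      exact m.2
    · intro hy
      exact ⟨⟨y, M.le_topologicalClosure hy⟩, ⟨⟨y, hy⟩, rfl⟩, rfl⟩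
  have hd : DenseRange incl := by
    rw [DenseRange, dense_iff_closure_eq, IsEmbedding.subtypeVal.closure_eq_preimage_closure_image, himg]
    apply Set.eq_univ_of_forall
    rintro ⟨x, hx⟩
    rw [Set.mem_preimage]
    change x ∈ closure (M : Set H)
    rwa [← Subgroup.topologicalClosure_coe]
  exact hd.equalizer hf hg (funext fun m => h m m.2)

/-! ## 1. The rotation closure `R := cl(η⟨t⟩)`, `t = embCu (1, r 1)` -/

section Rot

/-- Coordinates of `t^k = embCu (1, r 1)^k`: `(0, 0, r^k, 1)`. (toy bookkeeping; no claim about print)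
[cite: MochizukiEtTh2009, §1 p.12] -/
@[simp] theorem t_zpow_coords (k : ℤ) :
    (embCu l (1, r 1) ^ k).1.right = r 1 ^ k ∧ bC l (embCu l (1, r 1) ^ k) = 0 ∧ cC l (embCu l (1, r 1) ^ k) = 0 ∧
      (embCu l (1, r 1) ^ k).2 = 1 := by
  rw [← map_zpow]
  refine ⟨rfl, bC_embCu l _, ?_, embCu_snd l _⟩
  rw [cC_embCu]
  change toAdd ((1 : Multiplicative (ZMod l)) ^ k) = 0
  rw [one_zpow, toAdd_one]

/-- `dihedralRed l (r 1 ^ k) = r k` in `D_l`. (toy bookkeeping; no claim about print) [cite: MochizukiEtTh2009, §1 p.12] -/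
@[simp] theorem dihedralRed_r_one_zpow (k : ℤ) : dihedralRed l ((r 1 : DihedralGroup 0) ^ k) = r (k : ZMod l) := by
  rw [map_zpow, dihedralRed_r, map_one, r_one_zpow]

/-- Coordinates of `inl v = ((v, 1), 1) ∈ TG l`. (toy bookkeeping; no claim about print) [cite: MochizukiEtTh2009, Def 2.5 p.39] -/
@[simp] theorem inl_coords (v : Multiplicative (ZMod l × ZMod l)) :
    (show TG l from ((SemidirectProduct.inl v : TG₀ l), (1 : Multiplicative (ZMod 2)))).1.right = 1 ∧
      bC l (show TG l from ((SemidirectProduct.inl v : TG₀ l), (1 : Multiplicative (ZMod 2)))) = (toAdd v).1 ∧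
      cC l (show TG l from ((SemidirectProduct.inl v : TG₀ l), (1 : Multiplicative (ZMod 2)))) = (toAdd v).2 ∧
      (show TG l from ((SemidirectProduct.inl v : TG₀ l), (1 : Multiplicative (ZMod 2)))).2 = 1 :=
  ⟨rfl, rfl, rfl, rfl⟩

/-- `t^k · inl(v) · t^{-k} = inl(r^k · v)` (unipotent monodromy `(b, c) ↦ (b, c + k b)`). (toy bookkeeping; no claim about
print) [cite: MochizukiEtTh2009, Def 2.1 p.36] -/
theorem t_zpow_conj_inl (k : ℤ) (v : Multiplicative (ZMod l × ZMod l)) :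
    MulAut.conj (embCu l (1, r 1) ^ k) ((SemidirectProduct.inl v : TG₀ l), (1 : Multiplicative (ZMod 2))) =
      ((SemidirectProduct.inl (act l 1 (k : ZMod l) v) : TG₀ l), (1 : Multiplicative (ZMod 2))) := by
  rw [MulAut.conj_apply]
  refine TG.ext l ?_ ?_ ?_ ?_
  · simp
  · simp
  · simp
  · simp

/-- `ι t ι⁻¹ = t⁻¹`. (toy bookkeeping for [EtTh] Rmk. 2.1.1 «`ι` inverts the loop»; no claim about print)
[cite: MochizukiEtTh2009, Rmk 2.1.1 p.36] -/
theorem iotaT_conj_t : iotaT l * embCu l (1, r 1) * (iotaT l)⁻¹ = (embCu l (1, r 1))⁻¹ := by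
  rw [← MulAut.conj_apply, conj_iotaT_embCu, (sr_conj_dihedral 1).1, ← map_inv, Prod.inv_mk, inv_one, inv_r]

variable [NeZero l]

/-- Preimages under the coordinate map `Φ` are closed (`Φ` factors through the discrete finite shadow). (toy bookkeeping;
no claim about print) [cite: MochizukiEtTh2009, Def 2.1 p.36] -/
theorem isClosed_preimage_Phi (X : Set (heisPiC l)) : IsClosed (Phi l ⁻¹' X) := by
  have e : Phi l ⁻¹' X = Sh l ⁻¹' (TA.heis l ⁻¹' X) := rfl
  rw [e]
  exact (isClosed_discrete _).preimage (Sh l).continuous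

omit [NeZero l] in
/-- Elements of `η⟨t⟩`. (toy bookkeeping; no claim about print) [cite: MochizukiEtTh2009, §1 p.12] -/
theorem mem_map_zpowers_iff {x : PiC l} :
    x ∈ (Subgroup.zpowers (embCu l (1, r 1))).map (toHat l).toMonoidHom ↔ ∃ k : ℤ, x = toHat l (embCu l (1, r 1) ^ k) := by
  constructor
  · rintro ⟨g, hg, rfl⟩
    obtain ⟨k, rfl⟩ := Subgroup.mem_zpowers_iff.mp hg
    exact ⟨k, rfl⟩
  · rintro ⟨k, rfl⟩
    exact ⟨_, Subgroup.mem_zpowers_iff.mpr ⟨k, rfl⟩, rfl⟩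

omit [NeZero l] in
/-- A closed set containing `η⟨t⟩` contains `R`. (toy bookkeeping; no claim about print) [cite: MochizukiEtTh2009, §1 p.12] -/
theorem rot_subset_of_isClosed {R : Subgroup (PiC l)}
    (hR : R = ((Subgroup.zpowers (embCu l (1, r 1))).map (toHat l).toMonoidHom).topologicalClosure)
    {S : Set (PiC l)} (hS : IsClosed S) (h : ∀ k : ℤ, toHat l (embCu l (1, r 1) ^ k) ∈ S) : (R : Set (PiC l)) ⊆ S := by
  rw [hR, Subgroup.topologicalClosure_coe]
  refine closure_minimal (fun x hx => ?_) hS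
  obtain ⟨k, rfl⟩ := (mem_map_zpowers_iff l).mp hx
  exact h k

omit [NeZero l] in
/-- `η(t^k) ∈ R`. (toy bookkeeping; no claim about print) [cite: MochizukiEtTh2009, §1 p.12] -/
theorem toHat_t_zpow_mem {R : Subgroup (PiC l)}
    (hR : R = ((Subgroup.zpowers (embCu l (1, r 1))).map (toHat l).toMonoidHom).topologicalClosure) (k : ℤ) :
    toHat l (embCu l (1, r 1) ^ k) ∈ R := by
  rw [hR]
  exact Subgroup.le_topologicalClosure _ ((mem_map_zpowers_iff l).mpr ⟨k, rfl⟩)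

omit [NeZero l] in
/-- `η(t) ∈ R`. (toy bookkeeping; no claim about print) [cite: MochizukiEtTh2009, §1 p.12] -/
theorem toHat_t_mem {R : Subgroup (PiC l)}
    (hR : R = ((Subgroup.zpowers (embCu l (1, r 1))).map (toHat l).toMonoidHom).topologicalClosure) :
    toHat l (embCu l (1, r 1)) ∈ R := by
  simpa using toHat_t_zpow_mem l hR 1

/-- `Φ(η t^k) = r^k ∈ D_l`. (toy bookkeeping; no claim about print) [cite: MochizukiEtTh2009, §1 p.12] -/
theorem Phi_toHat_t_zpow (k : ℤ) :
    Phi l (toHat l (embCu l (1, r 1) ^ k)) = SemidirectProduct.inr (r (k : ZMod l)) := by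
  rw [Phi_toHat]
  refine SemidirectProduct.ext ?_ ?_
  · rw [sh₀_left, SemidirectProduct.left_inr]
    exact toAdd.injective (Prod.ext (t_zpow_coords l k).2.1 (t_zpow_coords l k).2.2.1)
  · rw [sh₀_right, SemidirectProduct.right_inr, (t_zpow_coords l k).1, dihedralRed_r_one_zpow]

/-- **`Φ(R) ⊆ ⟨r⟩`**: every element of the rotation closure maps to a rotation of the finite shadow.
(toy bookkeeping; no claim about print) [cite: MochizukiEtTh2009, §1 p.12] -/
theorem exists_Phi_eq_inr_r_of_mem_rot {R : Subgroup (PiC l)}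
    (hR : R = ((Subgroup.zpowers (embCu l (1, r 1))).map (toHat l).toMonoidHom).topologicalClosure)
    {x : PiC l} (hx : x ∈ R) : ∃ i : ZMod l, Phi l x = SemidirectProduct.inr (r i) := by
  let S : Set (PiC l) := Phi l ⁻¹' Set.range (fun i : ZMod l => (SemidirectProduct.inr (r i) : heisPiC l))
  have hS : IsClosed S := isClosed_preimage_Phi l _
  have hsub := rot_subset_of_isClosed l hR hS (fun k => ⟨(k : ZMod l), (Phi_toHat_t_zpow l k).symm⟩)
  obtain ⟨i, hi⟩ := hsub hx
  exact ⟨i, hi.symm⟩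

omit [NeZero l] in
/-- **The inversion inverts the rotation closure**: `η(ι) x η(ι)⁻¹ = x⁻¹` for `x ∈ R`.
(toy bookkeeping for [EtTh] Rmk. 2.1.1 at the model's completion; no claim about print) [cite: MochizukiEtTh2009, Rmk 2.1.1 p.36] -/
theorem iotaM_conj_of_mem_rot {R : Subgroup (PiC l)}
    (hR : R = ((Subgroup.zpowers (embCu l (1, r 1))).map (toHat l).toMonoidHom).topologicalClosure)
    {x : PiC l} (hx : x ∈ R) : iotaM l * x * (iotaM l)⁻¹ = x⁻¹ := by
  let S : Set (PiC l) := {x | iotaM l * x * (iotaM l)⁻¹ = x⁻¹}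
  have hS : IsClosed S := isClosed_eq ((continuous_const.mul continuous_id).mul continuous_const) continuous_inv
  refine rot_subset_of_isClosed l hR hS (fun k => ?_) hx
  change iotaM l * toHat l (embCu l (1, r 1) ^ k) * (iotaM l)⁻¹ = (toHat l (embCu l (1, r 1) ^ k))⁻¹
  rw [iotaM, ← map_mul, ← map_inv, ← map_mul, ← map_inv, ← MulAut.conj_apply, map_zpow, MulAut.conj_apply,
    iotaT_conj_t, inv_zpow', zpow_neg]

omit [NeZero l] in
/-- **`R` is abelian.** (toy bookkeeping; no claim about print) [cite: MochizukiEtTh2009, §1 p.12] -/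
theorem comm_of_mem_rot {R : Subgroup (PiC l)}
    (hR : R = ((Subgroup.zpowers (embCu l (1, r 1))).map (toHat l).toMonoidHom).topologicalClosure)
    {x y : PiC l} (hx : x ∈ R) (hy : y ∈ R) : x * y = y * x := by
  have step : ∀ y ∈ R, ∀ k : ℤ, toHat l (embCu l (1, r 1) ^ k) * y = y * toHat l (embCu l (1, r 1) ^ k) := by
    intro y hy k
    let S : Set (PiC l) := {y | toHat l (embCu l (1, r 1) ^ k) * y = y * toHat l (embCu l (1, r 1) ^ k)}
    have hS : IsClosed S := isClosed_eq (continuous_const.mul continuous_id) (continuous_id.mul continuous_const)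
    refine rot_subset_of_isClosed l hR hS (fun j => ?_) hy
    change toHat l (embCu l (1, r 1) ^ k) * toHat l (embCu l (1, r 1) ^ j) =
      toHat l (embCu l (1, r 1) ^ j) * toHat l (embCu l (1, r 1) ^ k)
    rw [← map_mul, ← map_mul, ← zpow_add, ← zpow_add, add_comm]
  let S : Set (PiC l) := {x | x * y = y * x}
  have hS : IsClosed S := isClosed_eq (continuous_id.mul continuous_const) (continuous_const.mul continuous_id)
  exact rot_subset_of_isClosed l hR hS (fun k => step y hy k) hx

/-- **The rotation closure acts on `(ℤ/l)²` through `Φ`**: `x · η(inl v) · x⁻¹ = η(inl(r^{λ(x)} · v))` for `x ∈ R`,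
`λ(x)` the rotation index of `Φ(x)` (unipotent monodromy `(b, c) ↦ (b, c + λ b)`, completed).
(toy bookkeeping for [EtTh] §2 at the model's completion; no claim about print) [cite: MochizukiEtTh2009, Prop 2.6 p.40] -/
theorem conj_toHat_inl_of_mem_rot {R : Subgroup (PiC l)}
    (hR : R = ((Subgroup.zpowers (embCu l (1, r 1))).map (toHat l).toMonoidHom).topologicalClosure)
    {x : PiC l} (hx : x ∈ R) (v : Multiplicative (ZMod l × ZMod l)) :
    x * toHat l ((SemidirectProduct.inl v : TG₀ l), 1) * x⁻¹ =
      toHat l ((SemidirectProduct.inl (act l 1 (rotIdx l (Phi l x).right) v) : TG₀ l), 1) := by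
  let S : Set (PiC l) := {x | x * toHat l ((SemidirectProduct.inl v : TG₀ l), 1) * x⁻¹ =
      toHat l ((SemidirectProduct.inl (act l 1 (rotIdx l (Phi l x).right) v) : TG₀ l), 1)}
  have hS : IsClosed S := by
    refine isClosed_eq ((continuous_id.mul continuous_const).mul continuous_inv) ?_
    have e : (fun x : PiC l => toHat l ((SemidirectProduct.inl (act l 1 (rotIdx l (Phi l x).right) v) : TG₀ l), 1)) =
        (fun a : TA l => toHat l ((SemidirectProduct.inl (act l 1 (rotIdx l (TA.heis l a).right) v) : TG₀ l), 1)) ∘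
          Sh l := rfl
    rw [e]
    exact continuous_of_discreteTopology.comp (Sh l).continuous
  refine rot_subset_of_isClosed l hR hS (fun k => ?_) hx
  change toHat l (embCu l (1, r 1) ^ k) * toHat l _ * (toHat l (embCu l (1, r 1) ^ k))⁻¹ = _
  rw [Phi_toHat_t_zpow, SemidirectProduct.right_inr, rotIdx_r, ← map_mul, ← map_inv, ← map_mul, ← MulAut.conj_apply,
    t_zpow_conj_inl]

omit [NeZero l] in
/-- Coordinates of the sheet element `(1, e) ∈ TG l`. (toy bookkeeping; no claim about print) [cite: MochizukiEtTh2009, Def 2.5 p.39] -/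
@[simp] theorem sheet_coords (e : Multiplicative (ZMod 2)) :
    (show TG l from ((1 : TG₀ l), e)).1.right = 1 ∧ bC l (show TG l from ((1 : TG₀ l), e)) = 0 ∧
      cC l (show TG l from ((1 : TG₀ l), e)) = 0 ∧ (show TG l from ((1 : TG₀ l), e)).2 = e :=
  ⟨rfl, rfl, rfl, rfl⟩

omit [NeZero l] in
/-- **Normal form in `TG l`**: `g = inl(v) · embCu(1, d) · (1, e)` with `(v, d, e)` the coordinates of `g`.
(toy bookkeeping; no claim about print) [cite: MochizukiEtTh2009, Def 2.5 p.39] -/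
theorem eq_inl_mul_embCu_mul_sheet (g : TG l) :
    g = (show TG l from ((SemidirectProduct.inl g.1.left : TG₀ l), (1 : Multiplicative (ZMod 2)))) * embCu l (1, g.1.right) *
      (show TG l from ((1 : TG₀ l), g.2)) := by
  refine TG.ext l ?_ ?_ ?_ ?_
  · simp
  · simp only [bC_mul, right_mul, (inl_coords l _).2.1, embCu_right, bC_embCu, (sheet_coords l _).2.1,
      mul_zero, add_zero]
    rfl
  · simp only [cC_mul, right_mul, (inl_coords l _).2.2.1, embCu_right,
      bC_embCu, cC_embCu, (sheet_coords l _).2.1, (sheet_coords l _).2.2.1, mul_zero, add_zero, toAdd_one]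
    rfl
  · simp

omit [NeZero l] in
/-- `embCu (1, r i) = t^i` and `embCu (1, sr i) = ι t^i`. (toy bookkeeping; no claim about print) [cite: MochizukiEtTh2009, §1 p.12] -/
theorem embCu_one_dihedral (i : ZMod 0) :
    embCu l (1, r i) = embCu l (1, r 1) ^ (show ℤ from i) ∧ embCu l (1, sr i) = iotaT l * embCu l (1, r 1) ^ (show ℤ from i) := by
  have h1 : embCu l (1, r i) = embCu l (1, r 1) ^ (show ℤ from i) := by
    rw [← map_zpow]
    congr 1
    refine Prod.ext (by simp) ?_
    change (r i : DihedralGroup 0) = r 1 ^ (show ℤ from i)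
    exact (r_one_zpow_int (show ℤ from i)).symm
  refine ⟨h1, ?_⟩
  rw [← h1, show iotaT l = embCu l (1, sr 0) from rfl, ← map_mul, Prod.mk_mul_mk, one_mul, sr_mul_r, zero_add]

omit [NeZero l] in
/-- **Generation**: two homomorphisms out of `TG l` that agree on `inl((ℤ/l)²)`, on `t`, on `ι` and on the sheet factor agree.
(toy bookkeeping; no claim about print) [cite: MochizukiEtTh2009, Def 2.5 p.39] -/
theorem monoidHom_TG_ext {X : Type*} [Group X] {φ ψ : TG l →* X}
    (hinl : ∀ v, φ ((SemidirectProduct.inl v : TG₀ l), (1 : Multiplicative (ZMod 2))) =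
      ψ ((SemidirectProduct.inl v : TG₀ l), (1 : Multiplicative (ZMod 2))))
    (ht : φ (embCu l (1, r 1)) = ψ (embCu l (1, r 1))) (hι : φ (iotaT l) = ψ (iotaT l))
    (he : ∀ e : Multiplicative (ZMod 2), φ ((1 : TG₀ l), e) = ψ ((1 : TG₀ l), e)) : φ = ψ := by
  have hd : ∀ d : DihedralGroup 0, φ (embCu l (1, d)) = ψ (embCu l (1, d)) := by
    intro d
    rcases d with i | i
    · rw [(embCu_one_dihedral l i).1, map_zpow, map_zpow, ht]
    · rw [(embCu_one_dihedral l i).2, map_mul, map_mul, map_zpow, map_zpow, ht, hι]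
  ext g
  rw [eq_inl_mul_embCu_mul_sheet l g, map_mul, map_mul, map_mul, map_mul, hinl, hd, he]

end Rot

end Literature.AnabelianGeometry.EtaleTheta.ThetaCovers.MonodromyModel

end
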